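import Literature.NumberTheory.EllipticCurves.MordellCurvePhiDescentHom
import Mathlib.NumberTheory.Padics.PadicNumbers
import HarnessLib

/-!
# `ℚ(S, 3)`: a rational number whose valuations off `S` are divisible by `3` is, modulo cubes, a product
# of primes of `S` with exponents `< 3` (Cohen–Pazuki, *Elementary 3-descent with a 3-isogeny*, Thm. 2.1 (3), `D = 1`)

Topic `NumberTheory/EllipticCurves`. The elementary `S`-unit reduction over `ℚ` for cube classes
(`MordellDescent.CubeUnits ℚ = ℚ*/ℚ*³`, `MordellDescent.cubeClass`), the cubic analogue of the tree's
square-class reduction `exists_squarefree_dvd_sqClass_eq` (`TwoIsogenySelmerGroupRankProofs`) behind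
Silverman's «`S^{(φ)}(E/ℚ) ⊆ ℚ(S, 2)`» (AEC X.4.9). For the `3`-isogeny descent of [CohenPazuki2009] with
`D = 1`, Theorem 2.1 (3) reads: «if `u = α((x, y))` we can choose `u ∈ ℤ` and cubefree … `u ∣ (2b)²`»;
combined with the valuation theorem `Valuation.three_dvd_log_threeTorsionDescent` (tree, the unramified
part of Thm. 2.1 (2)) the present file gives the box `α(E(ℚ)) ⊆ {[∏_{p ∣ 2s} p^{e_p}] : e_p < 3}`.
Everything here is proved; no named facts, no curves.

* `Nat.exists_eq_pow_three_of_dvd_padicValNat` — a natural number all of whose prime valuations are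
  divisible by `3` is a cube.
* `Rat.exists_eq_cube_or_neg_cube` — a non-zero rational all of whose `p`-adic valuations are divisible
  by `3` is `± r³`; hence (`cubeClass_eq_one_of_forall_dvd`) its cube class is trivial.
* **`cubeClass_eq_prod_of_support`** — if `3 ∣ v_p(q)` for every prime `p ∉ S` (`S` a finite set of
  primes) then `[q] = [∏_{p ∈ S} p^{e_p}]` in `ℚ*/ℚ*³` with `e_p = v_p(q) mod 3 < 3`.
* `three_dvd_padicValRat_iff_log` — the bridge `3 ∣ log (Rat.padicValuation p q) ↔ 3 ∣ padicValRat p q`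
  to the `ℤᵐ⁰`-valued statements of `ThreeTorsionDescentValuation`.

## References

* [CohenPazuki2009] H. Cohen, F. Pazuki, Acta Arith. 140 (2009), Theorem 2.1 (3) and its proof
  («we can choose `u ∈ ℤ` and cubefree»).
* [SilvermanAEC2009] J. H. Silverman, *AEC* 2nd ed., Prop. X.4.9 (`ℚ(S, 2)`), the quadratic template.
-/

open scoped Classical

namespace Literature.NumberTheory.EllipticCurves

namespace MordellDescent

open WithZero

/-! ## Cubes in `ℕ` and `ℚ` from valuations -/

/-- A non-zero natural number all of whose prime valuations are divisible by `3` is a cube.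
[cite: CohenPazuki2009, Theorem 2.1 (3) (proof: cubefree representatives)] -/
theorem _root_.Nat.exists_eq_pow_three_of_dvd_padicValNat {n : ℕ} (hn : n ≠ 0)
    (h : ∀ p : ℕ, p.Prime → 3 ∣ padicValNat p n) : ∃ m : ℕ, n = m ^ 3 := by
  -- `m = ∏ p^{v_p(n)/3}`
  set f : ℕ →₀ ℕ := n.factorization with hf
  let g : ℕ →₀ ℕ := Finsupp.mapRange (fun k => k / 3) (by simp) f
  refine ⟨g.prod (· ^ ·), ?_⟩
  have hg : ∀ p ∈ g.support, p.Prime := by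
    intro p hp
    have : p ∈ f.support := Finsupp.support_mapRange hp
    exact Nat.prime_of_mem_primeFactors (by simpa [hf] using this)
  have hm0 : g.prod (· ^ ·) ≠ 0 := by
    rw [Finsupp.prod, Finset.prod_ne_zero_iff]
    intro p hp
    exact pow_ne_zero _ (hg p hp).ne_zero
  apply Nat.eq_of_factorization_eq hn (pow_ne_zero 3 hm0)
  intro p
  rw [Nat.factorization_pow, Nat.prod_pow_factorization_eq_self hg]
  simp only [Finsupp.coe_smul, Pi.smul_apply, smul_eq_mul, Finsupp.mapRange_apply, g]
  by_cases hp : p.Prime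
  · have h3 := h p hp
    rw [← Nat.factorization_def n hp] at h3
    rw [hf]
    omega
  · rw [hf, Nat.factorization_eq_zero_of_not_prime n hp]

/-- A non-zero rational number all of whose `p`-adic valuations are divisible by `3` is `± r³`.
[cite: CohenPazuki2009, Theorem 2.1 (3) (proof: cubefree representatives)] -/
theorem _root_.Rat.exists_eq_cube_or_neg_cube {q : ℚ} (hq : q ≠ 0)
    (h : ∀ p : ℕ, p.Prime → (3 : ℤ) ∣ padicValRat p q) :
    ∃ r : ℚ, r ≠ 0 ∧ (q = r ^ 3 ∨ q = -(r ^ 3)) := by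
  have hnum : q.num ≠ 0 := Rat.num_ne_zero.mpr hq
  have hden : q.den ≠ 0 := q.den_nz
  have hcop : q.num.natAbs.Coprime q.den := q.reduced
  -- both numerator and denominator have valuations divisible by `3`
  have key : ∀ p : ℕ, p.Prime → 3 ∣ padicValNat p q.num.natAbs ∧ 3 ∣ padicValNat p q.den := by
    intro p hp
    haveI : Fact p.Prime := ⟨hp⟩
    have hv : padicValRat p q = (padicValNat p q.num.natAbs : ℤ) - (padicValNat p q.den : ℤ) := by
      rw [padicValRat, padicValInt]
    have h3 := h p hp
    rw [hv] at h3
    by_cases hpn : p ∣ q.num.natAbs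
    · have hpd : ¬ p ∣ q.den := fun hd => by
        have h1 := Nat.dvd_gcd hpn hd
        rw [hcop.gcd_eq_one] at h1
        exact hp.one_lt.ne' (Nat.dvd_one.mp h1)
      rw [padicValNat.eq_zero_of_not_dvd hpd] at h3 ⊢
      refine ⟨?_, dvd_zero 3⟩
      have : (3 : ℤ) ∣ (padicValNat p q.num.natAbs : ℤ) := by simpa using h3
      exact_mod_cast this
    · rw [padicValNat.eq_zero_of_not_dvd hpn] at h3 ⊢
      refine ⟨dvd_zero 3, ?_⟩
      have : (3 : ℤ) ∣ (padicValNat p q.den : ℤ) := by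
        have e : ((0 : ℕ) : ℤ) - (padicValNat p q.den : ℤ) = -(padicValNat p q.den : ℤ) := by simp
        rw [e, dvd_neg] at h3
        exact h3
      exact_mod_cast this
  obtain ⟨a, ha⟩ := Nat.exists_eq_pow_three_of_dvd_padicValNat (Int.natAbs_ne_zero.mpr hnum)
    (fun p hp => (key p hp).1)
  obtain ⟨b, hb⟩ := Nat.exists_eq_pow_three_of_dvd_padicValNat hden (fun p hp => (key p hp).2)
  have hb0 : (b : ℚ) ≠ 0 := by
    have : b ≠ 0 := fun h0 => hden (by rw [hb, h0]; norm_num)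
    exact_mod_cast this
  have ha0 : (a : ℚ) ≠ 0 := by
    have : a ≠ 0 := fun h0 => (Int.natAbs_ne_zero.mpr hnum) (by rw [ha, h0]; norm_num)
    exact_mod_cast this
  refine ⟨(a : ℚ) / b, div_ne_zero ha0 hb0, ?_⟩
  have hq' : q = (q.num : ℚ) / (q.den : ℚ) := (Rat.num_div_den q).symm
  rcases Int.natAbs_eq q.num with hs | hs
  · left
    rw [hq', hs, ha, hb]; push_cast; ring
  · right
    rw [hq', hs, ha, hb]; push_cast; ring

/-- A non-zero rational whose valuations are all divisible by `3` has trivial cube class. [cite: CohenPazuki2009, Theorem 2.1 (3)] -/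
theorem cubeClass_eq_one_of_forall_dvd {q : ℚ} (hq : q ≠ 0)
    (h : ∀ p : ℕ, p.Prime → (3 : ℤ) ∣ padicValRat p q) : cubeClass q = 1 := by
  obtain ⟨r, hr, hqr | hqr⟩ := Rat.exists_eq_cube_or_neg_cube hq h
  · rw [hqr, cubeClass_pow_three]
  · rw [hqr, show -(r ^ 3) = (-r) ^ 3 by ring, cubeClass_pow_three]

/-! ## The box `ℚ(S, 3)` -/

/-- The valuation of a product of powers of the primes of `S` at a prime `p`: the exponent of `p` if
`p ∈ S`, else `0`. [folklore] -/
private theorem padicValRat_prod_pow (S : Finset ℕ) (hS : ∀ p ∈ S, p.Prime) (e : ℕ → ℕ)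
    (p : ℕ) [hp : Fact p.Prime] :
    padicValRat p (∏ ℓ ∈ S, ((ℓ : ℚ)) ^ e ℓ) = if p ∈ S then (e p : ℤ) else 0 := by
  induction S using Finset.induction_on with
  | empty => simp
  | @insert a S ha ih =>
    have hS' : ∀ p ∈ S, p.Prime := fun p hp' => hS p (Finset.mem_insert_of_mem hp')
    have haP : a.Prime := hS a (Finset.mem_insert_self a S)
    have ha0 : ((a : ℚ)) ^ e a ≠ 0 := pow_ne_zero _ (by exact_mod_cast haP.ne_zero)
    have hprod0 : ∏ ℓ ∈ S, ((ℓ : ℚ)) ^ e ℓ ≠ 0 :=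
      Finset.prod_ne_zero_iff.mpr fun ℓ hℓ => pow_ne_zero _ (by exact_mod_cast (hS' ℓ hℓ).ne_zero)
    rw [Finset.prod_insert ha, padicValRat.mul ha0 hprod0, ih hS', padicValRat.pow]
    have hva : padicValRat p (a : ℚ) = if p = a then 1 else 0 := by
      split_ifs with hpa
      · subst hpa; exact padicValRat.self hp.out.one_lt
      · rw [padicValRat.of_nat]
        have : padicValNat p a = 0 :=
          padicValNat.eq_zero_of_not_dvd fun hd => hpa ((Nat.prime_dvd_prime_iff_eq hp.out haP).mp hd)
        simp [this]
    by_cases hpa : p = a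
    · subst hpa
      simp [hva, ha]
    · simp [hva, hpa]

/-- **`ℚ(S, 3)`**: if `q ∈ ℚ*` has `3 ∣ v_p(q)` for every prime `p ∉ S` (`S` a finite set of primes),
then modulo cubes `q` is a product of primes of `S` with exponents `< 3`:
`[q] = [∏_{p ∈ S} p^{e_p}]`, `e_p = v_p(q) mod 3`. For the `3`-descent values `u = α(P)` this is
Cohen–Pazuki's «we can choose `u ∈ ℤ` and cubefree» with `u` supported on `S`.
[cite: CohenPazuki2009, Theorem 2.1 (3)] -/
theorem cubeClass_eq_prod_of_support (S : Finset ℕ) (hS : ∀ p ∈ S, p.Prime) {q : ℚ} (hq : q ≠ 0)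
    (h : ∀ p : ℕ, p.Prime → p ∉ S → (3 : ℤ) ∣ padicValRat p q) :
    ∃ e : ℕ → ℕ, (∀ p, e p < 3) ∧ cubeClass q = cubeClass (∏ p ∈ S, ((p : ℚ)) ^ e p) := by
  let e : ℕ → ℕ := fun p => ((padicValRat p q) % 3).toNat
  have he3 : ∀ p, e p < 3 := by
    intro p
    have h1 : (padicValRat p q) % 3 < 3 := Int.emod_lt_of_pos _ (by norm_num)
    have h2 : 0 ≤ (padicValRat p q) % 3 := Int.emod_nonneg _ (by norm_num)
    simp only [e]; omega
  have hecast : ∀ p, ((e p : ℕ) : ℤ) = (padicValRat p q) % 3 := by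
    intro p
    simp only [e, Int.toNat_of_nonneg (Int.emod_nonneg _ (by norm_num : (3 : ℤ) ≠ 0))]
  refine ⟨e, he3, ?_⟩
  set n : ℚ := ∏ p ∈ S, ((p : ℚ)) ^ e p with hn
  have hn0 : n ≠ 0 :=
    Finset.prod_ne_zero_iff.mpr fun ℓ hℓ => pow_ne_zero _ (by exact_mod_cast (hS ℓ hℓ).ne_zero)
  -- `q / n` has all valuations divisible by `3`
  have hw : cubeClass (q / n) = 1 := by
    refine cubeClass_eq_one_of_forall_dvd (div_ne_zero hq hn0) fun p hp => ?_
    haveI : Fact p.Prime := ⟨hp⟩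
    rw [padicValRat.div hq hn0, hn, padicValRat_prod_pow S hS e p]
    by_cases hpS : p ∈ S
    · rw [if_pos hpS, hecast]
      exact ⟨padicValRat p q / 3, by have := Int.emod_add_mul_ediv (padicValRat p q) 3; linarith⟩
    · rw [if_neg hpS, sub_zero]
      exact h p hp hpS
  have e1 : q = n * (q / n) := by field_simp
  rw [e1, cubeClass_mul hn0 (div_ne_zero hq hn0), hw, CubeUnits.mul_one]

/-! ## Bridge to `ℤᵐ⁰`-valued valuations -/

/-- `log (Rat.padicValuation p q) = −v_p(q)` for `q ≠ 0`. [folklore] -/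
private theorem log_padicValuation {p : ℕ} [Fact p.Prime] {q : ℚ} (hq : q ≠ 0) :
    WithZero.log (Rat.padicValuation p q) = -padicValRat p q := by
  rw [Rat.padicValuation]
  show WithZero.log (if q = 0 then 0 else exp (-padicValRat p q)) = _
  rw [if_neg hq, WithZero.log_exp]

/-- The bridge between the two currencies: `3 ∣ log (Rat.padicValuation p q) ↔ 3 ∣ v_p(q)`.
[cite: CohenPazuki2009, Theorem 2.1 (2)–(3)] -/
theorem three_dvd_padicValRat_iff_log {p : ℕ} [Fact p.Prime] {q : ℚ} (hq : q ≠ 0) :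
    (3 : ℤ) ∣ WithZero.log (Rat.padicValuation p q) ↔ (3 : ℤ) ∣ padicValRat p q := by
  rw [log_padicValuation hq, dvd_neg]

/-- `Rat.padicValuation p q = 1 ↔ v_p(q) = 0` (`q ≠ 0`): the hypothesis «`p ∤ 2b`» of the box in valuation
currency. [cite: CohenPazuki2009, Theorem 2.1 (2)–(3)] -/
theorem padicValuation_eq_one_iff {p : ℕ} [Fact p.Prime] {q : ℚ} (hq : q ≠ 0) :
    Rat.padicValuation p q = 1 ↔ padicValRat p q = 0 := by
  rw [Rat.padicValuation]
  show (if q = 0 then 0 else exp (-padicValRat p q)) = 1 ↔ _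
  rw [if_neg hq, ← WithZero.exp_zero, WithZero.exp_injective.eq_iff, neg_eq_zero]

/-- `Rat.padicValuation p q ≤ 1 ↔ 0 ≤ v_p(q)` (`q ≠ 0`): `q` is `p`-integral (the hypothesis «`a ∈ ℤ`» of the box
in valuation currency). [cite: CohenPazuki2009, Lemma 1.2 and Theorem 2.1] -/
theorem padicValuation_le_one_iff {p : ℕ} [Fact p.Prime] {q : ℚ} (hq : q ≠ 0) :
    Rat.padicValuation p q ≤ 1 ↔ 0 ≤ padicValRat p q := by
  rw [Rat.padicValuation]
  show (if q = 0 then 0 else exp (-padicValRat p q)) ≤ 1 ↔ _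
  rw [if_neg hq, ← WithZero.exp_zero, WithZero.exp_le_exp, neg_nonpos]

end MordellDescent

end Literature.NumberTheory.EllipticCurves
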